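import Literature.NumberTheory.DiophantineGeometry.GenEllBDClasses
import Literature.NumberTheory.DiophantineGeometry.GenEllProjLine
import Literature.NumberTheory.DiophantineGeometry.GenEllNorthcott
import HarnessLib

/-!
# [IUTchIV] Remarks 2.3.2–2.3.5 (after Corollary 2.3): the one checkable claim, typed; the
# commentary, located

Mochizuki, *Inter-universal Teichmüller theory IV: log-volume computations and set-theoretic
foundations*, RIMS manuscript (Apr. 2020; = PRIMS **57** (2021)), Remark 2.3.2 (i)(ii) (kurims-ms
pp. 56–57), Remark 2.3.3 (i)–(vii) (pp. 57–63), Remark 2.3.4 (p. 63), Remark 2.3.5 (i)–(iii)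
(pp. 63–66) [cite: Mochizuki2012, IV Rmk. 2.3.2 p.56] — thirteen census sub-items (cell node ids
`IUTchIV:Rmk2.3.2(i)` … `IUTchIV:Rmk2.3.5(iii)`), each read on the page (text `paper:url-56bcb0f95768`).
These Remarks follow Corollary 2.3 ("Diophantine Inequalities", p. 54: for a hyperbolic curve `U_X = X ∖ D`
over a number field, `d`, `ε > 0`: `ht_{ω_X(D)} ≲ (1+ε)(log-diff_X + log-cond_D)` on `U_X(ℚ̄)^{≤d}`), which
rests on the disputed chain ([IUTchIII] Cor. 3.12 → Thm. 1.10 → Cor. 2.2 → Cor. 2.3). Following the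
convention of this directory for expository Remarks (`Theorem110Remarks.lean`): each sub-item gets a
`/-! -/` section with its node id, locator and a one-line summary in the author's words; a sub-item that
states a CHECKABLE mathematical claim is typed as a named `Prop` (claim-form, not asserted); pure
commentary (analogies, methodology, history) carries no declaration and is never a FACT. Nothing here
takes a side on [IUTchIII] Cor. 3.12.

What is typed: **Rmk 2.3.2 (ii)** — "the constant “1” in the inequality of the display of Corollary 2.3
cannot be improved — cf. the examples constructed in [Mss]" — as `Rmk232.ConstantOneSharpStatement`,
over the tree's [GenEll] §1 vocabulary of the `λ`-line (`NFPoint`, `UPle`, `ht`, `logDiff`, `logCond`,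
`BDLe`: the case `X = ℙ¹_ℚ`, `D = {0, 1, ∞}` to which the proof of Cor. 2.3 reduces, p. 55).
Cross-reference (not re-typed): the elementary fact "`ℚ_{>0} ∩ Ẑ^× = {1}`" quoted in Rmk 2.3.3 (ii)
(p. 58) is PROVED in the tree as
`Literature.IUT.LogThetaLattice.Rat.eq_one_of_forall_padicValRat_eq_zero` (`RemarksArithmetic.lean`,
[IUTchIII] Rmk. 2.3.3 (vi)).
-/

noncomputable section

namespace Literature.IUT.LogVolume

open Literature.NumberTheory.DiophantineGeometry.GenEll

/-! ## `IUTchIV:Rmk2.3.2(i)` — Remark 2.3.2 (i) (p. 56) — noted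
"by arguing with a “bit more care”, it is not difficult to give stronger versions of the various
estimates that occur in Theorem 1.10; Corollaries 2.2, 2.3 and their proofs. Such stronger estimates
are, however, beyond the scope of the present series of papers". Commentary (no estimate is stated); no
declaration. -/

/-! ## `IUTchIV:Rmk2.3.2(ii)` — Remark 2.3.2 (ii) (pp. 56–57) — CLAIM typed below + commentary
"the constant “1” in the inequality of the display of Corollary 2.3 cannot be improved — cf. the
examples constructed in [Mss]; the discussion of Remark 1.10.5, (ii), (iii)" (typed:
`Rmk232.ConstantOneSharpStatement`). The rest is commentary: this "is closely related to discussions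
of how the theory … breaks down if one attempts to replace the first power of the étale theta function
by its `N`-th power for some integer `N ≥ 2` [cf. [IUTchIII], Cor. 3.12, Step (xi); Rmk. 3.12.1 (ii)]";
the `N`-th power operation "may also be thought of as corresponding to … replacing each Tate curve … by
the Tate curve whose `q`-parameter is given by the `N`-th power", an isogeny as in [GenEll] Lem. 3.5,
under which "the global height … will typically remain, up to a relatively small discrepancy,
unchanged" — "one of the essential observations that underlies the theory of [Falt]". -/

namespace Rmk232

/-- **Remark 2.3.2 (ii)**, the checkable claim (p. 56): "the constant “1” in the inequality of the display
of Corollary 2.3 cannot be improved — cf. the examples constructed in [Mss]" [`[Mss]` = D. W. Masser,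
Astérisque 183 (1990), bib `Masser1990` (examples showing Szpiro's inequality needs its `ε`); cf. also
Stewart–Tijdeman, Mh. Math. 102 (1986), bib `StewartTijdeman1986`]. CLAIM-FORM over the [GenEll] §1 vocabulary of the
`λ`-line `X = ℙ¹_ℚ`, `D = {0,1,∞}` (the case to which the proof of Cor. 2.3 reduces, p. 55): already for
`d = 1` the inequality of Cor. 2.3 with `ε = 0` — `ht_{ω_X(D)} ≲ 1 · (log-diff_X + log-cond_D)` on
`U_X(ℚ̄)^{≤1}` — FAILS (hence so does every constant `< 1`, the right-hand side being non-negative).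
[For `λ = a/c ∈ U_X(ℚ)`, `a + b = c` coprime: `ht = log c`, `log-diff = 0`, `log-cond = log rad(abc)`, so
this says `c / rad(abc)` is unbounded.] Typed, not asserted here.
-- TODO(general form): the Remark concerns the display of Cor. 2.3 for an arbitrary hyperbolic curve
-- `(X, D)`; the tree's [GenEll] vocabulary is that of the `λ`-line.
[cite: Mochizuki2012, IV Rmk. 2.3.2 (ii) p.56] -/
def ConstantOneSharpStatement : Prop :=
  ¬ BDLe (UPle 1) NFPoint.ht (fun P => P.logDiff + P.logCond)

/-- The claim of Rmk. 2.3.2 (ii) in the form "no constant `c ≤ 1` works": if the `ε = 0` inequality fails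
on `U_X(ℚ̄)^{≤1}`, then so does `ht ≲ c·(log-diff + log-cond)` for every `c ≤ 1` (since
`log-diff + log-cond ≥ 0` pointwise, `GenEllNorthcott`) — the bookkeeping half, PROVED.
[cite: Mochizuki2012, IV Rmk. 2.3.2 (ii) p.56] -/
theorem not_bdLe_of_constantOneSharp (h : ConstantOneSharpStatement) {c : ℝ} (hc : c ≤ 1) :
    ¬ BDLe (UPle 1) NFPoint.ht (fun P => c * (P.logDiff + P.logCond)) := by
  intro hc'
  apply h
  refine hc'.trans (BDLe.of_le fun P _ => ?_)
  have h0 : 0 ≤ P.logDiff + P.logCond := add_nonneg P.logDiff_nonneg P.logCond_nonneg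
  nlinarith

end Rmk232

/-! ## `IUTchIV:Rmk2.3.3(i)` — Remark 2.3.3 (i) (pp. 57–58) — noted
"Corollary 2.3 may be thought of as an effective version of the Mordell Conjecture"; comparison of the
"essential ingredients" of the proof of Cor. 2.3 with those of [Falt]: a "rough, informal list" for
[Falt] — (a) geometry of numbers, heights, Hermite–Minkowski; (b) global class field theory; (c) `p`-adic
Hodge–Tate decompositions; (d) finite flat group schemes; (e) isogenies and Tate modules; (f)
polarizations; (g) logarithmic geometry of toroidal compactifications — and Weber's dissection of (b)
after [Lang1]: (b-1) local class field theory, (b-2) global density of primes (Universal Norm Index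
Inequality), (b-3) the Unit Theorem, (b-4) the global reciprocity law / existence of a conductor for the
Artin symbol, (b-5) Kummer theory. Commentary; no declaration. -/

/-! ## `IUTchIV:Rmk2.3.3(ii)` — Remark 2.3.3 (ii) (pp. 58–59) — noted (one quoted fact cross-referenced)
Item-by-item "reminiscences": (a)+(b-3) ↔ "the elementary algebraic number theory characterization of
nonzero global integers as roots of unity" ([IUTchIII] Prop. 3.10) and arithmetic degrees / global
realified Frobenioids; (b-1) ↔ `p`-adic absolute anabelian geometry ([AbsTopIII] Cor. 1.10 (i)); (b-2) ↔
the Prime Number Theorem (Props. 1.6, 2.1 (ii)); (b-4) ↔ "the application of the elementary fact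
`ℚ_{>0} ∩ Ẑ^× = {1}` in the multiradial algorithms for cyclotomic rigidity isomorphisms in the number
field case" ([IUTchI] Ex. 5.1 (v); [IUTchIII] Rmks. 2.3.2, 2.3.3) — that elementary fact is PROVED in the
tree (`Literature.IUT.LogThetaLattice.Rat.eq_one_of_forall_padicValRat_eq_zero`); (b-5) ↔ Kummer
theory; (c) ↔ [pGC]; (d) ↔ ramification computations for log-shells ([AbsTopIII]; Props. 1.1–1.4); (e) ↔
finite étale coverings of hyperbolic curves, Belyi maps / Belyi cuspidalizations; (f) ↔ commutators of
theta groups ([EtTh]); (g) ↔ combinatorial anabelian geometry ([SemiAnbd]; [IUTchI] §2). Commentary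
(analogies); no declaration. -/

/-! ## `IUTchIV:Rmk2.3.3(iii)` — Remark 2.3.3 (iii) (pp. 59–60) — noted
"many aspects of the theory of [Falt] may be regarded as “distant abelian ancestors”" / "“distant
arithmetically holomorphic ancestors” of certain aspects of the multiradial and mono-analytic theory";
the "naive goal of constructing some sort of “Frobenius morphism” on a number field [cf. [FrdI], §I3]":
within the arithmetic holomorphic structure of scheme theory "such a “Frobenius morphism” … cannot
exist", whereas "if one dismantles this arithmetic holomorphic structure … then one can indeed construct"
one. Commentary (thesis statements of the series); no declaration. -/

/-! ## `IUTchIV:Rmk2.3.3(iv)` — Remark 2.3.3 (iv) (p. 60) — noted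
The difference between the theory of global density of primes [(b-2)] ("coherence … of aggregations of
primes" = arithmetic holomorphic structure) and the Prime Number Theorem (primes "one by one" =
dismantling into additive and multiplicative structures, cf. [IUTchIII] Rmk. 3.12.2 (i)(c)). Commentary
(analogy); no declaration. -/

/-! ## `IUTchIV:Rmk2.3.3(v)` — Remark 2.3.3 (v) (pp. 60–61) — noted
The global reciprocity law [(b-4)] "depends, in an essential way, on nontrivial relationships between
local units … at one prime … and elements of local value groups … at another prime"; such relationships
are "fundamentally incompatible with the splittings/decouplings of local units and local value groups"
of the theory ([IUTchIII] Rmk. 2.3.3 (i), Rmk. 3.12.2 (i)(a); prime-strips, [IUTchI] Fig. I1.2).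
Commentary; no declaration. -/

/-! ## `IUTchIV:Rmk2.3.3(vi)` — Remark 2.3.3 (vi) (pp. 61–62) — noted
Reciprocity maps vs Kummer-theoretic isomorphisms: "Kummer-theoretic isomorphisms satisfy very strong
covariant [with respect to functions] functoriality properties", class field theory "may only be
conducted in very special arithmetic situations", its reciprocity maps are contravariant and "ill-suited
to … the evaluation of special functions at special points"; "the price … lies in the highly nontrivial
nature … of the cyclotomic rigidity algorithms" ([IUTchIII] Rmk. 2.3.3); local class field theory enters
only for MLF-Galois pairs ([IUTchII] Prop. 1.3 (ii)) and yields uniradial algorithms. Commentary; no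
declaration. -/

/-! ## `IUTchIV:Rmk2.3.3(vii)` — Remark 2.3.3 (vii) (pp. 62–63) — noted
Kronecker's Jugendtraum / Hilbert's twelfth problem; "Many of the ideas that appear in inter-universal
Teichmüller theory bear a much closer resemblance to the mathematics of the late nineteenth and early
twentieth centuries … than to the mathematics of the mid- to late twentieth century" (Gauss, Jacobi,
Kummer, Kronecker, Weber, Frobenius, Hilbert, Teichmüller); Belyi maps and [pGC] as "exceptions
proving the rule". Commentary (historical); no declaration. -/

/-! ## `IUTchIV:Rmk2.3.4` — Remark 2.3.4 (p. 63) — noted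
"Various aspects of the theory … are substantially reminiscent of the theory surrounding Bogomolov's
proof of the geometric version of the Szpiro Conjecture, as discussed in [ABKP], [Zh]" — "arithmetic
analogues", Bogomolov's proof "a sort of useful elementary guide, or blueprint [perhaps even a sort of
Rosetta stone!]"; credited to discussions with Ivan Fesenko (Dec. 2014 – Jan. 2015); details in
[BogIUT]. Commentary (analogy); no declaration. -/

/-! ## `IUTchIV:Rmk2.3.5(i)` — Remark 2.3.5 (i) (pp. 63–64) — noted
Parshin's proof of the Mordell Conjecture over complex function fields [Par]; the question (F. Voloch,
Sept. 2015) "Is it possible to apply some portion of the ideas of the inter-universal Teichmüller theory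
… to obtain a proof of the Mordell Conjecture over number fields without making use of Belyi maps …?" —
"The answer … is, as far as the author can see at the time of writing, “no”." (PB1): Parshin's proof
uses the holomorphic (Schwarz-theoretic / Kobayashi-distance) geometry of a two-dimensional complex
manifold, Bogomolov's the real analytic symplectic geometry of a one-dimensional real analytic manifold;
"Parshin's proof is best understood … as a proof that reflects a fundamentally qualitatively different
geometry … from Bogomolov's proof". Commentary (a question and the author's answer "no"; not a
mathematical statement); no declaration. -/

/-! ## `IUTchIV:Rmk2.3.5(ii)` — Remark 2.3.5 (ii) (pp. 64–65) — noted
(PB2) Parshin's proof "involves numerous holomorphic maps from the open unit disc", Bogomolov's "a fixed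
copy of the open unit disc"; (PB3) Parshin: "a rough qualitative [finiteness] result for families of
curves of arbitrary genus ≥ 2", Bogomolov: "a much finer explicit inequality, but only in the case of
families of elliptic curves"; (PB4) Bogomolov's estimates depend on "particular types of elements — such
as unipotent elements or commutators", Parshin's are "uniform for arbitrary [sufficiently small]
elements". Commentary (comparison); no declaration. -/

/-! ## `IUTchIV:Rmk2.3.5(iii)` — Remark 2.3.5 (iii) (pp. 65–66) — noted
The Schwarz-theoretic geometry of the disc "admits a “natural embedding” into" the theory via categories
of localizations ([GeoAnbd] §2, [AbsTopI] §4, [AbsTopII] §3) culminating in Belyi cuspidalizations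
([AbsTopII] §3; [AbsTopIII] §1): "Belyi maps play the role of the Schwarz-theoretic geometry of the open
unit disc, i.e., the role of realizing a sort of arithmetic version of analytic continuation"; hence any
search for an IUT proof of Mordell "appears to lead inevitably to some application of Belyi maps".
Commentary; no declaration. -/

end Literature.IUT.LogVolume
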